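import Summits.ValiantsHypothesis.ValiantsHypothesis.Theorems.IntegralOrbitsTauBurgisserDet
import Mathlib.RingTheory.Polynomial.Cyclotomic.Basic
import Mathlib.NumberTheory.Padics.PadicVal.Basic

/-!
# Strategy census on crux `IntegralOrbits.TauConjecture` (stmt-ValiantsHypothesis-0336) — typed signatures

Every statement named in STRATEGY-CENSUS.md, as an elaborating `Prop` over tree declarations
(`tauPoly`, `tauInt`, `constantFreeComplexity`, `complexity`, `pochhammerWilkinson`). Nothing is asserted;
the two implications that are cheap are proved (`lConjecture_imp`, `digit_of_tau`), the rest are recorded as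
`Prop`s with their status in the docstring. Companion of `Sketch.lean` (the PW-power slice and the certified
alternative glue `closes_of_pwSlice`).
-/

set_option linter.dupNamespace false

namespace Summit.ValiantsHypothesis.ValiantsHypothesis.Cruxes.TauConjecture.Strategist

open Polynomial
open Literature.Computability.AlgebraicComplexity
open Summit.ValiantsHypothesis.ValiantsHypothesis.Theses.IntegralOrbits

/-! ## Strengthen -/

/-- **S⁺_L — the free-constants ("L_ℤ") form.** Integer roots bounded polynomially in Bürgisser's total
complexity `complexity` over `ℤ` (arbitrary integer constants and sum coefficients free). Implies the crux since
`complexity ≤ constantFreeComplexity`. Status: OPEN; on square-root towers `u_{i+1} = u_i² + c_i` (L ≤ 2d) it is the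
closed route SqrtTowers' `TowerUniform` (full towers with 2^d roots exist for d ≤ 4). -/
def LConjecture : Prop :=
  ∃ c : ℕ, ∀ f : Polynomial ℤ, f ≠ 0 →
    f.roots.toFinset.card ≤ (complexity ((MvPolynomial.uniqueAlgEquiv ℤ (Fin 1)).symm f) + 2) ^ c

/-- **S⁺_fac — the irreducible-factor-count form (REFUTED, see `not_factorCountBound_witness` in the census):**
the number of distinct monic irreducible divisors of `f` is polynomial in `τ(f)`. Witness against it:
`f = X^N − 1`, `N = lcm(1,…,K)`: `τ(f) ≤ 2 log₂ N + 1 = O(K)` but `f` has `d(N) ≥ 2^{π(K)}` distinct cyclotomic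
divisors `Φ_m`, `m ∣ N`. (Linear factors: only `X ± 1`.) -/
def FactorCountBound : Prop :=
  ∃ c : ℕ, ∀ f : Polynomial ℤ, f ≠ 0 → ∀ S : Finset (Polynomial ℤ),
    (∀ g ∈ S, g.Monic ∧ Irreducible g ∧ g ∣ f) → S.card ≤ (tauPoly f + 2) ^ c

/-- The refuting family, typed: for every `c` some `X^N − 1` has more than `(τ + 2)^c` distinct monic irreducible
(cyclotomic) divisors. Pen-and-paper: `N = lcm(1..K)`, `S = {Φ_m : m ∣ N}` (Mathlib `Polynomial.cyclotomic`,
`cyclotomic.irreducible`, `prod_cyclotomic_eq_X_pow_sub_one`), `τ(X^N − 1) ≤ 2⌊log₂ N⌋ + 1` by square-and-multiply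
(`constantFreeComplexity_X_pow_two_pow_le`, `_mul_le`, `_sub_le`); numbers: K = 200 gives τ ≤ 452 and
4.75·10¹⁵ divisors. Recorded as a `Prop` (not proved here). -/
def FactorCountWitness : Prop :=
  ∀ c : ℕ, ∃ N : ℕ, 0 < N ∧
    (tauPoly ((X : Polynomial ℤ) ^ N - 1) + 2) ^ c < (N.divisors.image fun m => cyclotomic m ℤ).card

/-- **S⁺_SGP — the single-good-prime (adelic-flavoured) form.** Some prime separating the integer roots sees at
most `(τ+2)^c` roots of `f mod p`. Implies the crux (the integer roots inject into the roots mod `p`). By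
Chebotarev it is equivalent to: the crux AND "some `σ ∈ Gal(f)` fixes at most poly(τ) irrational roots" — extra
Galois content orthogonal to the crux; no leverage (census §Strengthen). -/
def SingleGoodPrime : Prop :=
  ∃ c : ℕ, ∀ f : Polynomial ℤ, f ≠ 0 → ∃ p : ℕ, p.Prime ∧
    (∀ x ∈ f.roots.toFinset, ∀ y ∈ f.roots.toFinset, (p : ℤ) ∣ x - y → x = y) ∧
    ((Finset.range p).filter fun a : ℕ => (p : ℤ) ∣ f.eval (a : ℤ)).card ≤ (tauPoly f + 2) ^ c

/-- `S⁺_L` implies the crux: `L(f) ≤ τ(f)` (tree: `complexity_le_constantFreeComplexity_holds`, with the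
existence of a constant-free circuit `exists_computes_hasSignConstants_holds`). -/
theorem tau_of_lConjecture (h : LConjecture) : TauConjecture := by
  obtain ⟨c, hc⟩ := h
  refine ⟨c, fun f hf => (hc f hf).trans (Nat.pow_le_pow_left (Nat.add_le_add_right ?_ 2) c)⟩
  exact complexity_le_constantFreeComplexity_holds
    (ArithCircuit.exists_computes_hasSignConstants_holds _)

/-! ## Decomposition -/

/-- **Rojas' p-adic Digit Conjecture at the prime `p`** (arXiv:math/0304100, §1, "p-adic Digit Conjecture 1"):
the integer roots `x ≡ 1 (mod p)` of a nonzero `f` number at most `(τ(f)+2)^{c_p}`. Rojas, Thm. 1: for ONE prime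
`p` it implies the τ-conjecture (via Thm. 2 below and the rescaling `x = p^v b + p^{v+1} w`). The crux implies it
trivially (`digit_of_tau`). Its natural p-adic strengthening (count roots in `ℤ_p`, `≡ 1 mod p`) is FALSE:
Phillipson–Rojas arXiv:1011.4128 Lemma 1.11 (Poonen): `h_{n,k}/(x(1−x))` has `2^{n−1} − 1` roots in `1 + pℤ_p`
for every `p ≤ p_k`, at `τ = O(n + k log² k)`. So inside the disc integrality must again be used: the open piece is
the crux localised, not eased. -/
def PAdicDigitConjecture (p : ℕ) : Prop :=
  ∃ c : ℕ, ∀ f : Polynomial ℤ, f ≠ 0 →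
    (f.roots.toFinset.filter fun x : ℤ => (p : ℤ) ∣ x - 1).card ≤ (tauPoly f + 2) ^ c

/-- The crux gives every digit conjecture (subset of the roots). -/
theorem digit_of_tau (h : TauConjecture) (p : ℕ) : PAdicDigitConjecture p := by
  obtain ⟨c, hc⟩ := h
  exact ⟨c, fun f hf => (Finset.card_filter_le _ _).trans (hc f hf)⟩

/-- **Rojas 2003, Thm. 2, integer-root τ-form** (PROVED in print for additive complexity `σ ≤ τ` and all roots in
`ℂ_p^×`): the nonzero integer roots of `f` have at most `τ(τ+1)/2` distinct `p`-adic valuations. The genuine,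
provable piece of Rojas' reduction; formalisable with the tree's `constantFreeComplexity_*_le` API plus an
ultrametric Newton-polygon induction (size L). -/
def RojasValuationBound : Prop :=
  ∀ p : ℕ, p.Prime → ∀ f : Polynomial ℤ, f ≠ 0 →
    ((f.roots.toFinset.filter (· ≠ 0)).image fun x : ℤ => padicValInt p x).card ≤
      tauPoly f * (tauPoly f + 1) / 2

/-- **Root height bound** (folklore; degree ≤ 2^τ and ‖f‖₁ ≤ 2^(2^τ) by induction on the circuit, then Cauchy):
integer roots of a nonzero `f` satisfy `|x| ≤ 2^(2^τ(f))`. Needed to keep the rescaling constants `p^v b` cheap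
(`v ≤ 2^τ`, so `τ(p^v) ≤ 2τ + 2 log₂ p`). -/
def RootHeightBound : Prop :=
  ∀ f : Polynomial ℤ, f ≠ 0 → ∀ x ∈ f.roots.toFinset, |x| ≤ 2 ^ (2 ^ tauPoly f)

/-- **Rojas' reduction, typed** (arXiv:math/0304100 Thm. 1, second sentence): one digit conjecture + Thm. 2 +
heights ⇒ the crux. Glue in words: `Z(f) ≤ [f(0)=0] + Σ_{v ∈ V} Σ_{b=1}^{p−1} Z₁(g_{v,b})` where the roots `x` with
`ord_p x = v`, `x p^{-v} ≡ b (mod p)` are exactly `x = p^v (z + b − 1)` with `z ≡ 1 (mod p)` an integer root of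
`g_{v,b}(Z) := f(p^v (Z + b − 1))` (an affine substitution: `τ(g_{v,b}) ≤ τ(f) + τ(p^v) + τ(b−1) + 2`, tree
`constantFreeComplexity_aeval_le`; `v ≤ 2^τ` by `RootHeightBound`, so `τ(p^v) ≤ 2τ + 2 log₂ p`), and
`|V| ≤ τ(τ+1)/2` by `RojasValuationBound`. Recorded as the statement of the implication; NOT filed as a route split
(census §Decomposition: the open piece is the crux in a disc, Lemma 1.11). -/
def RojasReduction : Prop :=
  (∃ p : ℕ, p.Prime ∧ PAdicDigitConjecture p) → RojasValuationBound → RootHeightBound → TauConjecture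

/-- **The integer face of the slice the route consumes** (cf. `PWPowerMultiplesHardQP` in `Sketch.lean`;
Shub–Smale 1995 / Bürgisser 2024 §4.6: "it suffices to prove that for all nonzero integers m_n the sequence
(m_n·n!) is hard to compute"; here with powers and at quasi-polylog granularity): for every `c`, infinitely often
every `N·(2^e·n!)^d` has `τ_ℤ > 2^((log₂ log₂ n + c)^c)`. Implies the polynomial slice by evaluating
`g_n = N(2^e f_n)^d` at `x = n + 1` (`f_n(n+1) = n!`, cost `+ 2 log₂(n+1) + 2`, absorbed by `c ↦ c + 1`). -/
def FactorialPowerMultiplesHardQP : Prop :=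
  ∀ c n₁ : ℕ, ∃ n ≥ n₁, ∀ (N : ℤ) (e d : ℕ), N ≠ 0 → 1 ≤ d →
    2 ^ ((Nat.log 2 (Nat.log 2 n) + c) ^ c) < tauInt (N * ((2 : ℤ) ^ e * (n.factorial : ℤ)) ^ d)

/-! ## Negation -/

/-- **The counterexample shape the route fears** (negation of the slice): cheap sign-constant circuits for some
`N·(2^e·f_n)^d` at all large `n`. By Lipton 1994 (LNCS 877, 71–79) / Strassen 1976 / BCSS 1998 such circuits,
already at size `2^((log log n)^{O(1)})` = quasi-polynomial in the bit-length of `n`, factor integers by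
`gcd(g_n(a) mod M, M)` in quasi-polynomial size (nonuniformly / on average): the obstruction to building the
counterexample is cryptographic, not a lemma. -/
def CheapPWPowerMultiples : Prop :=
  ∃ c n₁ : ℕ, ∀ n ≥ n₁, ∃ (N : ℤ) (e d : ℕ), N ≠ 0 ∧ 1 ≤ d ∧
    tauPoly (C N * (C ((2 : ℤ) ^ e) * pochhammerWilkinson n) ^ d) ≤ 2 ^ ((Nat.log 2 (Nat.log 2 n) + c) ^ c)

end Summit.ValiantsHypothesis.ValiantsHypothesis.Cruxes.TauConjecture.Strategist
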